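import Summits.Ventures.PercRepro.RankLevelSetLevelSixHeavySq28C
import Summits.Ventures.PercRepro.RankLevelSetLevelFiveSharp

/-!
# PercRepro — C-025 AT LEVEL `6` FOR EVERY `p ≥ 28`, EVERY FINITE MATROID, UNCONDITIONAL (p8 g6, S3 §3s)

`proofs/SUBCLAIM-S3-p8.md` §3s. `c025_six_of_five_heavy_sq28c` (RankLevelSetLevelSixHeavySq28C: p4's cubic multiplicity,
the disjoint pair count, the windowed heavy term, the level-by-level tail, p3's `cq3` table, p1's unconditional 4-circuit
table with the averaging recursion, the 5-circuit averaging table) on p7's level-`5` row `c025_five_large_sharp27 (27 ≤ p)`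
(RankLevelSetLevelFiveSharp). One line; its closure is the union of the two closures of RankLevelSetLevelSixHeavySq28C
(ClosureSq28C-A / -B) and p7's. Axioms: standard.
-/

open scoped Matroid

namespace PercRepro

namespace ThmN

variable {α : Type}

/-- **C-025 AT LEVEL `6` FOR EVERY `p ≥ 28`, EVERY FINITE MATROID, UNCONDITIONAL** — `c025_six_of_five_heavy_sq28c` on
p7's level-`5` row `c025_five_large_sharp27 (27 ≤ p)`. -/
theorem c025_six_large_twenty_eight (M : Matroid α) [M.Finite] (p : ℕ) (hp : 28 ≤ p) : RLS M p 6 :=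
  c025_six_of_five_heavy_sq28c (fun M _ p hp => c025_five_large_sharp27 M p (by omega)) M p hp

/-- The same in the vocabulary of `C025`: the level-`6` frontier is every `p ≥ 28`. -/
theorem c025_six_large_twenty_eight' (M : Matroid α) [M.Finite] (p : ℕ) (hp : 28 ≤ p) :
    phiK p 6 * ({A : Set α | A ⊆ M.E ∧ M.eRk A = (p : ℕ∞) ∧ M.eRk (M.E \ A) = (6 : ℕ∞)}.ncard : ℚ) ≤
      ({A : Set α | A ⊆ M.E ∧ (6 : ℕ∞) < M.eRk A ∧ M.eRk A < (p : ℕ∞)}.ncard : ℚ) :=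
  c025_six_large_twenty_eight M p hp

end ThmN

end PercRepro
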